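import Mathlib
import HarnessLib
import HarnessLib.Audit
import Summits.MatrixMultiplication.Statement
import Literature.Computability.AlgebraicComplexity.FlatteningBound

/-!
Route: HalfDimensionGLn

CLOSED (superseded) 2026-08-17T03:03:41Z by planner-rrepair-MatrixMultiplication-HalfDimen-6185f12b-0 — reason: superseded:route-MatrixMultiplication-GLnSeparatingDesigns — superseded by route-MatrixMultiplication-GLnSeparatingDesigns — note: route-repair(cone) rrepair-MatrixMultiplication-HalfDimen-6185f12b: (1) CONE AUDITED CLEAN — the 2 unproved named facts of the module cone are Literature.Computability.AlgebraicComplexity.MatrixMultiplication (= omega(C)=2, [status: open], the CONCLUSION of closes) and .MatrixMultiplicationAllFields. The file is kept as the record of this route; refuted decls are indexed as negative knowledge (`ledger negatives`).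

# Route HalfDimensionGLn — BCGPU program completion — half-dimensional TPP border designs in GL_n(C)
with degree-optimal separating polynomials give omega = 2 (Cor 2.8)

PROGRAM COMPLETION (lens `complete`) of the infinite-group framework of
Blasiak–Cohn–Grochow–Pratt–Umans (arXiv:2204.03826 ITCS 2023;
arXiv:2410.14905 ITCS 2025). It suffices to show X = K ∧ C where K = HalfDimensionalBorderDesigns is
the authors' KEY QUESTION (§4 p. 33,
bullets 1–2: for every η > 0 some GL_n(ℂ), n ≥ 1, carries, beyond every degree budget s, a TPP
design of finitely many 1-parameter families
with border-separating polynomials of degree ≤ s and |X|, |Y|, |Z| ≥ s^(n²/2 − ηn)) and C =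
BorderPolynomialCost is the programme's own
REDUCTION, printed — Thm 2.6 + Lemma 2.7 + Cor 2.8: every such design is priced (|X||Y||Z|)^(ω/3) ≤
(s+1)^(C(n,2)(ω−2))·C(s+n²,n²) — filed as
a crux only because it is typed slightly beyond print (rank 4; a vendoring/formalisation task). The
deciding theorem `closes : K → C → ω(ℂ) = 2`
is Cor 2.8's "in particular" clause with the exponent bookkeeping kernel-checked (η := (ω−2)/(4ω), s
> 2^((C(n,2)(ω−2)+n²)/(n(ω−2)/4))).
Second crux L = LieInvariantDesigns is the authors' Lemma-D reduction of K ("all we have to do is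
find an appropriate finite subset of Y and
a single polynomial p", p. 9): a decodable half-dimensional pair plus ONE bi-invariant border
separator of the middle set, linked to K by the
support SplittingLink (= Lemma 2.11). Cards realised: lie-mixed-real-forms-small-k (its target is K
verbatim; its (T)/(C) diagnosis is the
why-now input), u3-four-and-a-half-dimensions (fixed-n reading of Cor 2.8).
Lean: `HalfDimensionalBorderDesigns ∧ BorderPolynomialCost`

## Assembly
`closes` (glue.lean, sorry-free, kernel-checked in the native self-check; both hypotheses are
cruxes): rewrite the summit as ω(ℂ) = 2
(MatrixMultiplication_iff); 2 ≤ ω is the tree's omega_two_le; if 2 < ω put η := (ω−2)/(4ω) > 0, take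
n ≥ 1 from K and a degree budget
s ≥ max(n², ⌈2^(E/g)⌉ + 2) with E := C(n,2)(ω−2) + n², g := n(ω−2)/4; K's design has volume ≥
s^(3(n²/2 − ηn)), so C gives
s^((n²/2−ηn)ω) ≤ (s+1)^(C(n,2)(ω−2))·C(s+n²,n²) ≤ (2s)^E (Nat.choose_le_pow, s ≥ n²), i.e. s^g ≤ 2^E
since (n²/2−ηn)ω = E + g
(Nat.cast_choose_two, field_simp) — contradicting s > 2^(E/g). L reaches K through the support
SplittingLink (unused-crux advisory on L
expected until that link is proved; LevelGradedCohnUmans precedent).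

Rationale: WHY THIS LINE. BlasiakCohnGrochowPrattUmans2024 (arXiv:2410.14905) Thm 2.2/2.6 price a TPP triple in
ANY group by Σ_(ρ∈R_sep)(dim ρ)^ω once RepFun(R_sep)
holds (border-)separating functions; in GL_n(ℂ) the polynomial irreps of degree ≤ s are a basis of
Pol_≤s (de Concini–Eisenbud–Procesi) and
have dim ≤ (s+1)^C(n,2) (Weyl's formula; Lemma 2.7), so Cor 2.8 turns "TPP + degree-s separation +
size s^(n²/2−o(n))" into ω = 2, and §4
(p. 33) prints the remaining steps: such a construction IN GL_n (bullet 1; their Thm C lives in the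
unitary-type SU_(n/2,n/2) where designs
cap at s^(n²/4)) approaching half dimension at rate o(n) not Θ(n) (bullet 2). Imported areas:
representation theory of GL_n (cost side),
Lie algebras + invariant theory + border rank (Lemma 2.11, the design reduction), real forms /
incidence geometry for the design.
What no listed route does: NilpotentLieHosts hosts §4 bullets 3–4 (other / fixed infinite groups,
enveloping-algebra pricing in U_d(ℤ),
where the Θ(n)-escape is unavailable); LevelGradedCohnUmans and CongruenceTowerPacking use Thm 2.2
in FINITE groups GL_m(F_p), U_n(ℤ/p^k); the
GL_n(ℂ) key question with Cor 2.8 as closes is hosted nowhere (59 routes read). WHY-NOW per gap: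
reduction — the tree proved the corrected
Thm 2.2 (BCGPU2024_thm_2_2_corrected_holds, embedding-form TPP; the printed §1 convention is refuted
in S₃), so C is one vendoring chain away
(border passage + GL_n polynomial irreps, C's birth skeleton); bullet 2 — the hub's (C)/(T)
diagnosis (card lie-mixed-real-forms-small-k,
refuter-confirmed unprinted): two conjugates of U_n meet in ⊇ a maximal torus, so EVERY
conjugate-compact K-TPP triple loses Θ(n) — the
o(n) rate needs non-conjugate real forms or non-subgroup designs, a design space nobody has typed;
bullet 1 — the hub's separation-degree
LP pipeline (kit j004055, card su2-…-v2) measures sepdeg growth (q vs q²) of candidate GL_3/GL_4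
designs this week. Negatives index: empty
for this class.

RANKED CRUXES. #2 HalfDimensionalBorderDesigns (crux) — BCGPU's KEY QUESTION (§4 p. 33, bullets 1–2
in GL_n): for every η > 0 there is n ≥ 1 such that for arbitrarily large degree budgets s there are
TPP border designs X, Y, Z (finite sets of 1-parameter families ℝ → GL_n(ℂ), TPP in embedding form
on (0,α)) with degree-≤-s border-separating polynomial families (uniform O(ε) error) and |X|, |Y|,
|Z| ≥ s^(n²/2 − ηn) ("sets of size q^(dim G/2 − o(n)) … in GL_n rather than U_n", degree q^(1+o(1))
absorbed into s). [difficulty: open-problem] (why it might fail: "the construction falls short … it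
approaches half the dimension at a rate of Θ_n(n) rather than o_n(n), and … it is in a unitary
group" (p. 24): conjugate-compact triples lose a maximal torus (structural Θ(n)), ℂ-subvarieties are
barred (BCGPU23 Thm 4.7), no other half-dim TPP geometry is known.) [arXiv:2410.14905,
arXiv:2204.03826, CohnUmans2003, BlasiakCohnGrochowPrattUmans2024]
#3 LieInvariantDesigns (crux) — Lemma-2.11 ("Lemma D", p. 9/19) DATA AT HALF DIMENSION in GL_n(ℂ):
for every η > 0 some n ≥ 1, d ≥ n²/2 − ηn and a pair f_X, f_Z : ℂ^d → M_n(ℂ) with polynomial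
decoders p_X(f_X v − f_Z w) = v, p_Z(…) = w of bounded degree D, such that for arbitrarily large s
there are an alphabet A ⊂ ℂ (|A| = q, q^d ≥ s^(n²/2−ηn)), a finite set Y of bounded 1-parameter
families with |Y| ≥ s^(n²/2−ηn) and ONE polynomial family p₀ of degree ≤ s − 2qdD, invariant under
left exp(t f_X a) and right exp(−t f_Z b) (a, b ∈ A^d), border-separating the identity on Y⁻¹Y ("all
we have to do is find an appropriate finite subset of Y and a single polynomial p"). [difficulty:
open-problem] (why it might fail: The polynomial decoders force 2d ≤ n² and make the generated X, Z
huge unless the pair is special; for the only half-dimensional pairs in print (conjugates of U_n,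
Thm 3.3/Lemma 3.12) the zero-diagonal restriction costs d = n²/2 − Θ(n), and Inv_(X,Z) may be too
small for any other pair.) [arXiv:2410.14905, BlasiakCohnGrochowPrattUmans2024,
BlasiakCohnGrochowPrattUmans2023]
#4 BorderPolynomialCost (crux) — THE PROGRAMME'S REDUCTION (printed, typed slightly beyond print):
BCGPU24 Thm 2.6 + Cor 2.8 (border clause) with Lemma 2.7 in the weaker Weyl-formula form dim ρ ≤
(s+1)^C(n,2): every TPP border design in GL_n(ℂ) (arbitrary 1-parameter families, uniform O(ε)
separation) with degree-≤-s border-separating polynomials satisfies (|X||Y||Z|)^(ω/3) ≤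
(s+1)^(C(n,2)(ω−2)) · C(s+n², n²). Vendoring chain (its birth skeleton): tree
BCGPU2024_thm_2_2_corrected_holds → border version (rank → border rank: Euclidean closure of
restrictions = Zariski closure, Alder / BCS §20) → polynomial irreps of GL_n span Pol_≤s with Σ dim²
= C(s+n²,n²) (dCEP80) → Weyl bound. [difficulty: L] (why it might fail: Typed beyond print twice:
Thm 2.6 for NON-analytic families with a uniform O(ε) bound (needs the closure = border-rank
passage), and Lemma 2.7 replaced by (s+1)^C(n,2) for ALL n, s; a slip there or in Σdim² = C(s+n²,n²)
falsifies it as stated (any poly(n) constant would still carry the programme).) [arXiv:2410.14905,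
BlasiakCohnGrochowPrattUmans2024, BurgisserClausenShokrollahi1997, Blaser2013]
#9 SplittingLink (support) — L → K = Lemma 2.11 (printed, pp. 19–22) specialised to G = GL_n(ℂ):
from the pair data take X' = {ε ↦ exp(ε f_X a) : a ∈ A^d}, Z' likewise (|X'| = |Z'| = q^d by the DPP
the decoders give), reparametrise Y and p₀ by ε ↦ ε^t with t > deg r_(a,b), and p_(x,z)(M, ε) :=
p₀(M, ε^t)·r_(a,b)((M − I)/ε) with r_(a,b) the Lagrange product over the decoders (degree ≤ 2qdD): a
TPP border design of degree ≤ s with all three sizes ≥ s^(n²/2−ηn) (K's birth skeleton is exactly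
this composition, kernel-checked from the ∀-form stub). [deps: LieInvariantDesigns] [difficulty: L]
[arXiv:2410.14905, BlasiakCohnGrochowPrattUmans2024]

TWO-LAYER PLAN. K ⇐ (non-conjugate real-form K-TPP subgroup triple with dim K = o(n)) → (K-slicing,
BCGPU23 Lemma 4.8, finite version) → (one invariant
border separator) → K, once a triple is proposed; registered birth line of K: Lemma 2.11 (∀-form
stub) + the Lemma-D data (= L) → K
(bc/HalfDimensionalBorderDesigns_birth.lean). L ⇐ FewValueInvariants (a bi-invariant ι taking
finitely many limiting values on Y⁻¹Y, the
architecture of Thm 2.10 / 3.1) → Interpolate (Lagrange on the value set, provable) → L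
(bc/LieInvariantDesigns_birth.lean). C ⇐ borderCost
(Thm 2.6 discrete, over the tree's repFun) → polynomialIrreps (dCEP80 + Weyl) → C with the tree's
sum_rpow_omega_le_of_le
(bc/BorderPolynomialCost_birth.lean). All three compositions are kernel-checked; k = 2 each, depth
1.

KILL CRITERIA. A proof that every TPP border design in GL_n(ℂ) with degree-s separation has
|X||Y||Z| ≤ C_n·(s+1)^(3(n²/2 − c·n)) for some ABSOLUTE c > 0
and all n (a uniform Θ(n) defect law — the polynomial method's own packing barrier) refutes K and L
at once: close `refuted:HalfDimensionalBorderDesigns`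
and record the law under Literature/Barriers/MatrixMultiplication (it would be the first barrier for
infinite hosts). L refuted alone (e.g.
Inv_(X,Z) = ℂ for every decodable pair with d ≥ n²/2 − o(n)) ⇒ drop L, keep K with non-split
designs. C refuted AS TYPED (a constant slip in the
border passage / Lemma 2.7) ⇒ MISSTATED class: re-type C from the corrected cost (any
poly(n)·s^(o(n)) slack is absorbed by the same glue) and
re-certify `closes`; only a super-polynomial failure of the cost theorem would be substantive (it
would contradict Thm 2.6 itself). ω = 2
proved elsewhere moots the route; ω > 2 proved elsewhere refutes K via C.

NOT DECOMPOSED YET. (i) §4 bullet 1 ALONE (GL_n host, degree-optimal, size exponent → n²/2 in ratio: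
`HalfDimensionRatio`, typed in the planner's notes: ∀ θ < 1 ∃ n ≥ 1
… sizes ≥ s^(θn²/2)) and the U_n stepping stone of bullet 2 (sizes s^(n²/4 − o(n)) inside
unitary-type hosts) are NECESSARY for K, never
sufficient for `closes` (a fixed-defect design certifies only ω ≤ 2/(1−2c)) — pursued as first rungs
INSIDE K's crux chain (the running-example
transfer: unitriangular alphabet pairs have polynomial LU-decoders, so bullet 1 at θ → 1 − 1/n is
exactly "a unitary middle set of size
s^(n²/2−Cn) whose leading-principal-minor values on Y*Y number s^(1+o(1))", Lemma 2.13 / Thm 2.14 vs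
distinct distances), not filed as items
(unused-crux rule). (ii) The exact (non-border) special case of K (§4 says "separating polynomials";
exact ⇒ border by constant families).
(iii) The structural lemma (C) "U_n ∩ hU_nh⁻¹ ⊇ a maximal torus" (provable now, spectral theorem for
hh*) — a helper for K's disproof /
ideation files, not an item. (iv) Thm C's quarter-dimension instance of L in SU_(n/2,n/2) (d = n²/4
− n/2) as a calibration target for the
SplittingLink prover. (v) A named Literature predicate `BorderSeparatingDesign n s X Y Z` to shorten
the three items that inline it (definition
request later; not needed to open).

CHEAPEST FALSIFIER. (1) Derivation a refuter can do this week: does K-slicing of ANY real-form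
subgroup triple in GL_n(ℂ)_ℝ force total defect ≥ c·n (extend (C)
from conjugate-compact pairs to all pairs (H, H^g) of real forms via the Cartan decomposition)? A
two-page proof kills the subgroup sub-line of
K and L. (2) Compute (kit, the su2 card's sepdeg LP, exp/su2_sepdeg.py generalised to n = 2, 3): for
the mixed triple (U_n, D·GL_n(ℝ)·D⁻¹,
lower-unitriangular) at q = 2..5, is the minimal separating degree linear or quadratic in q?
Quadratic growth on every mixed candidate at
n ≤ 3 is evidence for the defect law. (3) In-Lean, done by the planner: the exponent bookkeeping of
Cor 2.8 with g(n) = ηn is kernel-checked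
(`closes`); the n = 1 slice of C caps abelian border designs at (s+1)^(3/2), so K's η < 1/6
instances cannot be met at n = 1 (root count),
guarding the `1 ≤ n` binder; n = 0 would trivialise K and L and is excluded.

NUMBERS. Threshold (Cor 2.8): size exponent n²/2 − o(n) per set at degree s (q ↔ s). In print: Thm
2.10/2.14 (L, O_n, U⁺ in GL_n(ℝ)): q^((n²−n)/2) at
degree O(q²) ⇒ s^((n²−n)/4); Thm C / 3.1 (SU_(n/2,n/2)): q^(n²/4 − n/2) at degree O(q) ⇒ s^(n²/4 −
n/2); BCGPU23 Thm 4.10/Rem 4.11: three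
conjugates of U_n, K = unit torus (dim n), sliced total 3n² − 2n real of 2n²·(3/2). Defect c·n
certifies only ω ≤ 2/(1 − 2c) (proof of Cor 2.8
with g(n) = cn); ω < 2.3713 needs c < 0.078. Lemma 2.7: dim ρ ≤ s^C(n,2) (n ≥ 3, s ≥ 2); typed here
as (s+1)^C(n,2) (all n, s). Items at open: 5.

DEFINITION REQUESTS. None needed to open (everything inlined over Mathlib:
Matrix.GeneralLinearGroup, MvPolynomial.totalDegree/eval, NormedSpace.exp, Finset of
families ℝ → GL_n(ℂ)). Fact request filed at open: `fact: BCGPU2024 Thm 2.6 + Cor 2.8 (border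
clause) for GL_n(ℂ)` into
Literature/Computability/AlgebraicComplexity/BCGPUInfiniteGroups.lean (discharges C by name).
Optional notion (later): `BorderSeparatingDesign`.

Novelty: Searches (2026-08-17): lit citing arXiv:2410.14905 (2: arXiv:2411.15789 unrelated, 1 w/o metadata);
lit citing arXiv:2204.03826 (11, none on
Lie designs); lit search --source zbmath "triple product property matrix multiplication Lie group"
--year-from 2023 (1: the paper itself);
lit galaxy search "separating polynomials triple product property" --star all (0), "triple product
property" --star pdf (6: CKSU05, Sawin,
Stothers ×2, BCGPU25, junk), "Lie exponent" --star pdf (10, none relevant); crossref "finite matrix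
multiplication algorithms infinite groups
Lie" 2025– (10, none); arXiv/OpenAlex/S2 APIs rate-limited (429) this session; new.md (47 works, 30
d): nothing on the framework; the 59 open
routes' theses and the cards u3-four-and-a-half-dimensions, lie-mixed-real-forms-small-k,
su2-separation-degree-incidence-v2,
needle-soft-separation read in full; tree: BCGPUInfiniteGroups*.lean (Thm 2.2 vendored, refuted as
printed, corrected and proved).
Nearest prior art found: arXiv:2410.14905 itself (§4 key question + bullets 1–2 = K; Lemma 2.11 =
the architecture of L; Cor 2.8 = C + closes) —
by design of the lens; nearest route route-MatrixMultiplication-NilpotentLieHosts (same paper,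
bullets 3–4, nilpotent host, enveloping-algebra
cost, no Θ(n) escape); nearest card lie-mixed-real-forms-small-k (variant: K as a slogan + the
(T)/(C) diagnosis, untyped, no route).
Delta: the first typed home of the GL_n(ℂ) key question with the printed reduction as a
kernel-checked crux-only decid  [refs: 2410.14905, 2411.15789, 2204.03826]

Barriers (technique_class: lie-hosts, separating-polynomials, border-rank): - technique_class: lie-hosts, separating-polynomials, border-rank
- Literature.Barriers.MatrixMultiplication.QuasirandomBarrier: finite groups of Lie type (large
second character degree); void for finite subsets of the infinite group GL_n(ℂ) — there is no
ambient finite group algebra (BCGPU24 §1); its infinite-host shadow is Remark 2.3's all-or-nothing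
(d_max ≈ D^(1/2)), built into the threshold n²/2 − o(n) of K.
- Literature.Barriers.MatrixMultiplication.NormalizerBarrier: subgroups of FINITE groups far from
self-normalising; void here (BCGPU23 Thm 4.10: conjugates of O_n/U_n evade it even in the Lie
analogy); the analogous structural loss for infinite hosts is the torus lemma (C), which K must
evade by leaving conjugate-compact triples — the bet.
- Literature.Barriers.MatrixMultiplication.NilpotentGroupBarrier: bounded-exponent nilpotent finite
groups / powers of a fixed group (slice rank); not this class (reductive infinite host, char 0, no
slice-rank handle on Pol_≤s(GL_n(ℂ))).
- Literature.Barriers.MatrixMultiplication.YoungSubgroupBarrier: Young subgroups of S_n; not this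
host.
- Literature.Barriers.MatrixMultiplication.TricoloredSumFreeBarrier: STPP in bounded-exponent
abelian groups; void (non-abelian, infinite; the n = 1 abelian slice of K is capped by root
counting, consistent).
- Literature.Barriers.MatrixMultiplication.InfimumNotMinimumBarrier: one design certifies only its
own exponent; K is a FAMILY (η → 0, s → ∞) — consistent, not evaded.
- Literature.Barriers.

History (route lifecycle, newest last):
- 2026-08-17T03:03:41Z · CLOSED superseded — superseded:route-MatrixMultiplication-GLnSeparatingDesigns (planner-rrepair-MatrixMultiplication-HalfDimen-6185f12b-0)

sub-problem: MatrixMultiplication · status: closed(superseded) · opened planner-plan-lens3-MatrixMultiplication-complete-0 2026-08-17T02:46:44Z · rev 0 · ledger route-MatrixMultiplication-HalfDimensionGLn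
GENERATED by the gate from the ledger (D-0016/17). Provers cite these decls: `theorem foo : Summit.MatrixMultiplication.MatrixMultiplication.Theses.HalfDimensionGLn.<Decl> := …` in Summits/MatrixMultiplication/MatrixMultiplication/Theorems/<Name>.lean.
-/

namespace Summit.MatrixMultiplication.MatrixMultiplication.Theses.HalfDimensionGLn

open scoped BigOperators Topology Manifold Classical MeasureTheory ProbabilityTheory Matrix InnerProductSpace ComplexConjugate ContinuousMap
open Filter Set Function TopologicalSpace MeasureTheory

attribute [summit_statement] _root_.MatrixMultiplication

/-- item stmt-MatrixMultiplication-18573 · crux · rank 2 · closed · moot by None · by planner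
why it might fail: "the construction falls short … it approaches half the dimension at a rate of Θ_n(n) rather than o_n(n), and … it is in a unitary group" (p. 24): conjugate-compact triples lose a maximal torus (structural Θ(n)), ℂ-subvarieties are barred (BCGPU23 Thm 4.7), no other half-dim TPP geometry is known.
sources: arXiv:2410.14905, arXiv:2204.03826, CohnUmans2003, BlasiakCohnGrochowPrattUmans2024
[crux] BCGPU's KEY QUESTION (§4 p. 33, bullets 1–2 in GL_n): for every η > 0 there is n ≥ 1 such
that for arbitrarily large degree budgets s there are TPP border designs X, Y, Z (finite sets of
1-parameter families ℝ → GL_n(ℂ), TPP in embedding form on (0,α)) with degree-≤-s border-separating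
polynomial families (uniform O(ε) error) and |X|, |Y|, |Z| ≥ s^(n²/2 − ηn) ("sets of size q^(dim G/2
− o(n)) … in GL_n rather than U_n", degree q^(1+o(1)) absorbed into s). [difficulty: open-problem] -/
@[route_item "route-MatrixMultiplication-HalfDimensionGLn"]
def HalfDimensionalBorderDesigns : Prop :=
  ∀ η : ℝ, 0 < η → ∃ n : ℕ, 1 ≤ n ∧ ∀ s₀ : ℕ, ∃ s : ℕ, s₀ ≤ s ∧ ∃ X Y Z : Finset (ℝ → Matrix.GeneralLinearGroup (Fin n) ℂ), (∃ α : ℝ, 0 < α ∧ (∀ ε ∈ Set.Ioo (0 : ℝ) α, ∀ x ∈ X, ∀ x' ∈ X, ∀ y ∈ Y, ∀ y' ∈ Y, ∀ z ∈ Z, ∀ z' ∈ Z, x ε * (y ε)⁻¹ * y' ε * (z ε)⁻¹ = x' ε * (z' ε)⁻¹ → x = x' ∧ y = y' ∧ z = z') ∧ (∀ x₀ ∈ X, ∀ z₀ ∈ Z, ∃ p : ℝ → MvPolynomial (Fin n × Fin n) ℂ, ∃ C : ℝ, ∀ ε ∈ Set.Ioo (0 : ℝ) α, (p ε).totalDegree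 ≤ s ∧ ∀ x ∈ X, ∀ y ∈ Y, ∀ y' ∈ Y, ∀ z ∈ Z, ((x = x₀ ∧ y = y' ∧ z = z₀) → ‖MvPolynomial.eval (fun ij : Fin n × Fin n => ((x ε * (y ε)⁻¹ * y' ε * (z ε)⁻¹ : Matrix.GeneralLinearGroup (Fin n) ℂ) : Matrix (Fin n) (Fin n) ℂ) ij.1 ij.2) (p ε) - 1‖ ≤ C * ε) ∧ (¬ (x = x₀ ∧ y = y' ∧ z = z₀) → ‖MvPolynomial.eval (fun ij : Fin n × Fin n => ((x ε * (y ε)⁻¹ * y' ε * (z ε)⁻¹ : Matrix.GeneralLinearGroup (Fin n) ℂ) : Matrix (Fin n) (Fin n) ℂ) ij.1 ij.2) (p ε)‖ ≤ C * ε))) ∧ (s : ℝ) ^ ((n : ℝ) ^ 2 / 2 - η * n) ≤ (X.card : ℝ) ∧ (s : ℝ) ^ ((n : ℝ) ^ 2 / 2 - η * n) ≤ (Y.card : ℝ) ∧ (s : ℝ) ^ ((n : ℝ) ^ 2 / 2 - η * n) ≤ (Z.card : ℝ)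

/-- item stmt-MatrixMultiplication-18574 · crux · rank 3 · closed · moot by None · by planner
why it might fail: The polynomial decoders force 2d ≤ n² and make the generated X, Z huge unless the pair is special; for the only half-dimensional pairs in print (conjugates of U_n, Thm 3.3/Lemma 3.12) the zero-diagonal restriction costs d = n²/2 − Θ(n), and Inv_(X,Z) may be too small for any other pair.
sources: arXiv:2410.14905, BlasiakCohnGrochowPrattUmans2024, BlasiakCohnGrochowPrattUmans2023
[crux] Lemma-2.11 ("Lemma D", p. 9/19) DATA AT HALF DIMENSION in GL_n(ℂ): for every η > 0 some n ≥
1, d ≥ n²/2 − ηn and a pair f_X, f_Z : ℂ^d → M_n(ℂ) with polynomial decoders p_X(f_X v − f_Z w) = v,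
p_Z(…) = w of bounded degree D, such that for arbitrarily large s there are an alphabet A ⊂ ℂ (|A| =
q, q^d ≥ s^(n²/2−ηn)), a finite set Y of bounded 1-parameter families with |Y| ≥ s^(n²/2−ηn) and ONE
polynomial family p₀ of degree ≤ s − 2qdD, invariant under left exp(t f_X a) and right exp(−t f_Z b)
(a, b ∈ A^d), border-separating the identity on Y⁻¹Y ("all we have to do is find an appropriate
finite subset of Y and a single polynomial p"). [difficulty: open-problem] -/
@[route_item "route-MatrixMultiplication-HalfDimensionGLn"]
def LieInvariantDesigns : Prop :=
  ∀ η : ℝ, 0 < η → ∃ (n d D : ℕ), 1 ≤ n ∧ (n : ℝ) ^ 2 / 2 - η * n ≤ d ∧ ∃ (fX fZ : (Fin d → ℂ) → Matrix (Fin n) (Fin n) ℂ) (pX pZ : Fin d → MvPolynomial (Fin n × Fin n) ℂ), (∀ i : Fin d, (pX i).totalDegree ≤ D ∧ (pZ i).totalDegree ≤ D) ∧ (∀ (v w : Fin d → ℂ) (i : Fin d), MvPolynomial.eval (fun ij : Fin n × Fin n => (fX v - fZ w : Matrix (Fin n) (Fin n) ℂ) ij.1 ij.2) (pX i) = v i ∧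 MvPolynomial.eval (fun ij : Fin n × Fin n => (fX v - fZ w : Matrix (Fin n) (Fin n) ℂ) ij.1 ij.2) (pZ i) = w i) ∧ ∀ s₀ : ℕ, ∃ (s q : ℕ) (A : Finset ℂ), s₀ ≤ s ∧ A.card = q ∧ (s : ℝ) ^ ((n : ℝ) ^ 2 / 2 - η * n) ≤ (q : ℝ) ^ d ∧ ∃ (Y : Finset (ℝ → Matrix.GeneralLinearGroup (Fin n) ℂ)) (p₀ : ℝ → MvPolynomial (Fin n × Fin n) ℂ) (α B C : ℝ), 0 < α ∧ (s : ℝ) ^ ((n : ℝ) ^ 2 / 2 - η * n) ≤ (Y.card : ℝ) ∧ (∀ ε ∈ Set.Ioo (0 : ℝ) α, (p₀ ε).totalDegree + 2 * q * d * D ≤ s) ∧ (∀ ε ∈ Set.Ioo (0 : ℝ) α, ∀ y ∈ Y, ∀ i j : Fin n, ‖((y ε : Matrix.GeneralLinearGroup (Fin n) ℂ) : Matrix (Fin n) (Fin n) ℂ) i j‖ ≤ B ∧ ‖(((y ε)⁻¹ : Matrix.GeneralLinearGroup (Fin n) ℂ) : Matrix (Fin n) (Fin n) ℂ) i j‖ ≤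 B) ∧ (∀ ε ∈ Set.Ioo (0 : ℝ) α, ∀ t ∈ Set.Ioo (0 : ℝ) α, ∀ a b : Fin d → ℂ, (∀ i, a i ∈ A) → (∀ i, b i ∈ A) → ∀ M : Matrix (Fin n) (Fin n) ℂ, MvPolynomial.eval (fun ij : Fin n × Fin n => (NormedSpace.exp (t • fX a) * M * NormedSpace.exp (-(t • fZ b)) : Matrix (Fin n) (Fin n) ℂ) ij.1 ij.2) (p₀ ε) = MvPolynomial.eval (fun ij : Fin n × Fin n => (M : Matrix (Fin n) (Fin n) ℂ) ij.1 ij.2) (p₀ ε)) ∧ (∀ ε ∈ Set.Ioo (0 : ℝ) α, ∀ y ∈ Y, ∀ y' ∈ Y, (y = y' → ‖MvPolynomial.eval (fun ij : Fin n × Fin n => (((y ε)⁻¹ * y' ε : Matrix.GeneralLinearGroup (Fin n) ℂ) : Matrix (Fin n) (Fin n) ℂ) ij.1 ij.2) (p₀ ε) - 1‖ ≤ C * ε) ∧ (y ≠ y' → ‖MvPolynomial.eval (fun ij : Fin n × Fin n => (((y ε)⁻¹ * y' ε : Matrix.GeneralLinearGroup (Fin n) ℂ) : Matrix (Fin n)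 (Fin n) ℂ) ij.1 ij.2) (p₀ ε)‖ ≤ C * ε))

/-- item stmt-MatrixMultiplication-18575 · crux · rank 4 · closed · moot by None · by planner
why it might fail: Typed beyond print twice: Thm 2.6 for NON-analytic families with a uniform O(ε) bound (needs the closure = border-rank passage), and Lemma 2.7 replaced by (s+1)^C(n,2) for ALL n, s; a slip there or in Σdim² = C(s+n²,n²) falsifies it as stated (any poly(n) constant would still carry the programme).
sources: arXiv:2410.14905, BlasiakCohnGrochowPrattUmans2024, BurgisserClausenShokrollahi1997, Blaser2013
[crux] THE PROGRAMME'S REDUCTION (printed, typed slightly beyond print): BCGPU24 Thm 2.6 + Cor 2.8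
(border clause) with Lemma 2.7 in the weaker Weyl-formula form dim ρ ≤ (s+1)^C(n,2): every TPP
border design in GL_n(ℂ) (arbitrary 1-parameter families, uniform O(ε) separation) with degree-≤-s
border-separating polynomials satisfies (|X||Y||Z|)^(ω/3) ≤ (s+1)^(C(n,2)(ω−2)) · C(s+n², n²).
Vendoring chain (its birth skeleton): tree BCGPU2024_thm_2_2_corrected_holds → border version (rank
→ border rank: Euclidean closure of restrictions = Zariski closure, Alder / BCS §20) → polynomial
irreps of GL_n span Pol_≤s with Σ dim² = C(s+n²,n²) (dCEP80) → Weyl bound. [difficulty: L] -/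
@[route_item "route-MatrixMultiplication-HalfDimensionGLn"]
def BorderPolynomialCost : Prop :=
  ∀ (n s : ℕ) (X Y Z : Finset (ℝ → Matrix.GeneralLinearGroup (Fin n) ℂ)), (∃ α : ℝ, 0 < α ∧ (∀ ε ∈ Set.Ioo (0 : ℝ) α, ∀ x ∈ X, ∀ x' ∈ X, ∀ y ∈ Y, ∀ y' ∈ Y, ∀ z ∈ Z, ∀ z' ∈ Z, x ε * (y ε)⁻¹ * y' ε * (z ε)⁻¹ = x' ε * (z' ε)⁻¹ → x = x' ∧ y = y' ∧ z = z') ∧ (∀ x₀ ∈ X, ∀ z₀ ∈ Z, ∃ p : ℝ → MvPolynomial (Fin n × Fin n) ℂ, ∃ C : ℝ, ∀ ε ∈ Set.Ioo (0 : ℝ) α, (p ε).totalDegree ≤ s ∧ ∀ x ∈ X, ∀ y ∈ Y, ∀ y' ∈ Y, ∀ z ∈ Z, ((x = x₀ ∧ y = y' ∧ z = z₀) → ‖MvPolynomial.eval (fun ij : Fin n × Fin n => ((x ε * (y ε)⁻¹ * y' ε * (z ε)⁻¹ : Matrix.GeneralLinearGroup (Fin n) ℂ) : Matrix (Fin n)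 (Fin n) ℂ) ij.1 ij.2) (p ε) - 1‖ ≤ C * ε) ∧ (¬ (x = x₀ ∧ y = y' ∧ z = z₀) → ‖MvPolynomial.eval (fun ij : Fin n × Fin n => ((x ε * (y ε)⁻¹ * y' ε * (z ε)⁻¹ : Matrix.GeneralLinearGroup (Fin n) ℂ) : Matrix (Fin n) (Fin n) ℂ) ij.1 ij.2) (p ε)‖ ≤ C * ε))) → ((X.card * Y.card * Z.card : ℕ) : ℝ) ^ (Literature.Computability.AlgebraicComplexity.omega ℂ / 3) ≤ ((s : ℝ) + 1) ^ ((n.choose 2 : ℝ) * (Literature.Computability.AlgebraicComplexity.omega ℂ - 2)) * (((s + n ^ 2).choose (n ^ 2) : ℕ) : ℝ)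

/-- item stmt-MatrixMultiplication-18576 · support · rank 9 · closed · moot by None · by planner
sources: arXiv:2410.14905, BlasiakCohnGrochowPrattUmans2024
[support] L → K = Lemma 2.11 (printed, pp. 19–22) specialised to G = GL_n(ℂ): from the pair data
take X' = {ε ↦ exp(ε f_X a) : a ∈ A^d}, Z' likewise (|X'| = |Z'| = q^d by the DPP the decoders
give), reparametrise Y and p₀ by ε ↦ ε^t with t > deg r_(a,b), and p_(x,z)(M, ε) := p₀(M,
ε^t)·r_(a,b)((M − I)/ε) with r_(a,b) the Lagrange product over the decoders (degree ≤ 2qdD): a TPP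
border design of degree ≤ s with all three sizes ≥ s^(n²/2−ηn) (K's birth skeleton is exactly this
composition, kernel-checked from the ∀-form stub). [deps: LieInvariantDesigns] [difficulty: L] -/
@[route_item "route-MatrixMultiplication-HalfDimensionGLn"]
def SplittingLink : Prop :=
  LieInvariantDesigns → HalfDimensionalBorderDesigns

/-- item stmt-MatrixMultiplication-18577 · assembly · rank 1 · closed · moot by None · by planner
sources: arXiv:2410.14905, Blaser2013
[assembly] HalfDimensionalBorderDesigns → BorderPolynomialCost → ω(ℂ) = 2 (the summit
`MatrixMultiplication`) — the type of `closes`. -/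
@[route_item "route-MatrixMultiplication-HalfDimensionGLn"]
def Assembly : Prop :=
  HalfDimensionalBorderDesigns → BorderPolynomialCost → MatrixMultiplication

end Summit.MatrixMultiplication.MatrixMultiplication.Theses.HalfDimensionGLn
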